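import Mathlib
import Summits.ValiantsHypothesis.ValiantsHypothesis.Theses.ForgivenCollisions
import Summits.ValiantsHypothesis.ValiantsHypothesis.Theorems.ForgivenCollisionsSyndromeUpperBoundLemmas

/-!
# Route ForgivenCollisions — item `SyndromeUpperBound` (stmt-ValiantsHypothesis-11571)

**Design / syndrome upper bound for the collision complexity**: for every `r ≥ 1` there is `C`
(here `C = 2^r + 1`) with `κ_r(n) = cosetComplexity (J_r(n)) per_n ≤ C · (n+1)^(r+1)` for all `n`.

Proof (the route's sketch; the three lemmas are in the sibling file
`ForgivenCollisionsSyndromeUpperBoundLemmas.lean`): take a Bertrand prime `n + 1 < p ≤ 2(n+1)`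
(`Nat.exists_prime_lt_and_le_two_mul`) and label column `c` by its power sums
`g c = ((c : ZMod p)^1, …, (c : ZMod p)^(r-1)) ∈ G = (ZMod p)^(r-1)`. By Newton's identities
`g` separates disjoint equal-size column sets of sizes `1, …, r-1` (`powerSum_label_separates`),
so the syndrome polynomial `f_g` is a representative, `f_g - per_n ∈ J_r(n)`
(`syndromePoly_sub_perPoly_mem_collisionIdeal`); its character expansion costs
`complexity f_g ≤ |G| (2n² + n + 2) + 1` (`complexity_syndromePoly_le`) with
`|G| = p^(r-1) ≤ (2(n+1))^(r-1)`, whence `κ_r(n) ≤ 2^r (n+1)^(r+1) + 1 ≤ (2^r + 1)(n+1)^(r+1)`.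

References: [doi:10.1007/BF02566968], [doi:10.1016/0196-6774(86)90019-2] (power-sum
syndromes), Bürgisser 2000 Def. 2.1, Glynn 2010, Pratt 2019 Thm. 53.
-/

noncomputable section

namespace Summit.ValiantsHypothesis.Theorems

open MvPolynomial Literature.Computability.AlgebraicComplexity
open scoped BigOperators

namespace ForgivenCollisions

/-! ### D. The syndrome upper bound `κ_r(n) ≤ (2^r + 1)(n+1)^(r+1)` -/

/-- **Syndrome upper bound with an explicit constant**: for `r ≥ 1` and every `n`,
`κ_r(n) ≤ (2^r + 1) · (n+1)^(r+1)`, witnessed by the syndrome polynomial of the power-sum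
labelling into `(ZMod p)^(r-1)` for a Bertrand prime `n + 1 < p ≤ 2(n+1)`. [folklore] -/
theorem collisionComplexity_le (r : ℕ) (hr : 1 ≤ r) (n : ℕ) :
    collisionComplexity ℂ r n ≤ (2 ^ r + 1) * (n + 1) ^ (r + 1) := by
  classical
  obtain ⟨p, hp, hnp, hp2⟩ := Nat.exists_prime_lt_and_le_two_mul (n + 1) (Nat.succ_ne_zero n)
  haveI : Fact p.Prime := ⟨hp⟩
  haveI : NeZero p := ⟨hp.ne_zero⟩
  -- the power-sum labelling of the columns by `(ZMod p)^(r-1)`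
  set g : Fin n → (Fin (r - 1) → ZMod p) :=
    fun t k => ((t : ℕ) : ZMod p) ^ ((k : ℕ) + 1) with hg
  -- the representative
  have hmem : syndromePoly ℂ g - perPoly (Fin n) ℂ ∈ collisionIdeal ℂ r n := by
    refine syndromePoly_sub_perPoly_mem_collisionIdeal ℂ fun A B hAB hcard h1 hAr => ?_
    exact powerSum_label_separates hp (by omega) (fun t k => by rw [hg]) A B hAB hcard h1
      (by omega)
  -- its cost
  have hcost := complexity_syndromePoly_le (G := Fin (r - 1) → ZMod p) g
  have hcardG : Fintype.card (Fin (r - 1) → ZMod p) = p ^ (r - 1) := by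
    rw [Fintype.card_fun, ZMod.card, Fintype.card_fin]
  rw [hcardG] at hcost
  -- numerics
  have hp2' : p ≤ 2 * (n + 1) := hp2
  have hpow : p ^ (r - 1) ≤ 2 ^ (r - 1) * (n + 1) ^ (r - 1) := by
    rw [← mul_pow]; exact Nat.pow_le_pow_left hp2' _
  have hquad : n * (2 * n) + n + 2 ≤ 2 * (n + 1) ^ 2 := by nlinarith
  have hbound : p ^ (r - 1) * (n * (2 * n) + n + 2) + 1 ≤ (2 ^ r + 1) * (n + 1) ^ (r + 1) := by
    have h1 : p ^ (r - 1) * (n * (2 * n) + n + 2) ≤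
        (2 ^ (r - 1) * (n + 1) ^ (r - 1)) * (2 * (n + 1) ^ 2) :=
      Nat.mul_le_mul hpow hquad
    have h2 : (2 ^ (r - 1) * (n + 1) ^ (r - 1)) * (2 * (n + 1) ^ 2) =
        2 ^ r * (n + 1) ^ (r + 1) := by
      obtain ⟨r', rfl⟩ : ∃ r', r = r' + 1 := ⟨r - 1, by omega⟩
      simp only [Nat.add_sub_cancel]
      ring
    have h3 : 1 ≤ (n + 1) ^ (r + 1) := Nat.one_le_pow _ _ (Nat.succ_pos n)
    calc p ^ (r - 1) * (n * (2 * n) + n + 2) + 1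
        ≤ 2 ^ r * (n + 1) ^ (r + 1) + (n + 1) ^ (r + 1) := by omega
      _ = (2 ^ r + 1) * (n + 1) ^ (r + 1) := by ring
  -- conclude
  refine le_trans ?_ hbound
  rw [collisionComplexity_def, cosetComplexity_le_iff_sub_mem]
  exact ⟨syndromePoly ℂ g, hmem, hcost⟩

end ForgivenCollisions

/-- **Closes item `SyndromeUpperBound` (stmt-ValiantsHypothesis-11571) of route
ForgivenCollisions**: for every `r ≥ 1` there is `C` (namely `C = 2^r + 1`) with
`κ_r(n) = cosetComplexity (J_r(n)) per_n ≤ C · (n+1)^(r+1)` for all `n` — the syndrome polynomial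
of the power-sum labelling modulo a Bertrand prime is a representative (Newton's identities make
the labelling `B_{r-1}`-separating) and its character expansion is a `ΣΠΣ` formula with
`p^(r-1) ≤ (2n+2)^(r-1)` products of `n` linear forms. [folklore] -/
theorem syndromeUpperBound_proof :
    Summit.ValiantsHypothesis.ValiantsHypothesis.Theses.ForgivenCollisions.SyndromeUpperBound := by
  unfold Summit.ValiantsHypothesis.ValiantsHypothesis.Theses.ForgivenCollisions.SyndromeUpperBound
  intro r hr
  exact ⟨2 ^ r + 1, fun n => ForgivenCollisions.collisionComplexity_le r hr n⟩

end Summit.ValiantsHypothesis.Theorems
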